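import Summits.Parity.BatemanHorn.Theorems.SelbergDelangeRigidityLSDRealSegmentTailsTwoEngineAux
import Literature.NumberTheory.Sieve.NairTenenbaumTheorem1Printed
import HarnessLib

/-!
# Route `SelbergDelangeRigidity`, crux `LSDRealSegment` (stmt-Parity-9770), line
# `product-anatomy-subcritical`: the restoration engine of `stub_tailsTwo` RE-BASED on the printed Nair–Tenenbaum
# Theorem 1 — the uniform constants

The landed chain `…TailsTwo{EngineAux,Engine,APriori,Rankin,Top,BalQ,Bal}.lean` proves the four tail clauses of
`stub_tailsTwo` conditionally on the named fact `Literature.NumberTheory.Sieve.NairTenenbaum1998_theorem1`, which is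
MISSTATED (Erratum 2 of `Literature/NumberTheory/Sieve/NairTenenbaumShortSums.lean`: it asserts Henriot's range
`0 < α < 1`, the printed Theorem 1 of Nair–Tenenbaum (Acta Math. 180 (1998), p. 125) only gives `0 < α < 1/2`), and on
`BugeaudEvertseGyory2018_SPartPolynomialValues`, which is now PROVED in the tree
(`BugeaudEvertseGyory2018_SPartPolynomialValues_holds`).  The chain consumes Nair–Tenenbaum only at `α = 1/4 < 1/2`
(`tailsTwo_engine`), so it can be re-based on the corrected named fact
`Literature.NumberTheory.Sieve.NairTenenbaum1998_theorem1_printed` (the printed theorem, verbatim the hypothesis of the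
proved bridge `NairTenenbaum1998_theorem1.henriotForm_of_printed`).  This file is the first link of the re-based chain
`…TailsTwoPrinted*.lean`:

* `tailsTwo_nt_uniform_printed` (registered helper): the printed Theorem 1 in Henriot's form on `0 < α < 1/2` with
  constants `c₀, C ≥ 0` uniform over all systems whose product has discriminant `|D| ≤ D₀` — the analogue of
  `tailsTwo_nt_uniform` (same proof: maximise the constants over the finitely many `D`).
-/

open Filter Finset Polynomial
open scoped BigOperators Topology Classical

namespace Summit.Parity.BatemanHorn.Cruxes.LSDRealSegment.ProductAnatomySubcritical

open Literature.NumberTheory.Sieve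
open ArithmeticFunction (cardFactors)
noncomputable section

/-- **tailsTwo_nt_uniform_printed** (registered helper of `stub_tailsTwo`, line `product-anatomy-subcritical`; CONDITIONAL
on the named fact `NairTenenbaum1998_theorem1_printed`, Nair–Tenenbaum 1998 Thm 1 AS PRINTED): Nair–Tenenbaum's Theorem 1
in Henriot's form on the printed range `0 < α < 1/2`, with constants `c₀, C ≥ 0` uniform over all systems whose product has
discriminant `|D| ≤ D₀` (maximise the constants over the finitely many `D`).  Re-basing of `tailsTwo_nt_uniform` via the
bridge `NairTenenbaum1998_theorem1_printed.henriotForm`. [folklore] -/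
theorem tailsTwo_nt_uniform_printed : NairTenenbaum1998_theorem1_printed →
    ∀ (k g D₀ : ℕ) (A B α δ ε : ℝ), 1 ≤ k → 1 ≤ A → 1 ≤ B → 0 < α → α < 1 / 2 → 0 < δ → δ < 1 →
    0 < ε → ε ≤ α * δ / (12 * (g : ℝ) ^ 2) →
    ∃ c₀ C : ℝ, 0 ≤ c₀ ∧ 0 ≤ C ∧ ∀ Q : Fin k → ℤ[X], (∀ j, Irreducible (Q j)) →
      (∀ i j, i ≠ j → IsCoprime ((Q i).map (Int.castRingHom ℚ)) ((Q j).map (Int.castRingHom ℚ))) →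
      HasNoFixedPrimeDivisor Q → (∏ j, Q j).natDegree = g → |(∏ j, Q j).discr| ≤ D₀ →
      ∀ F : (Fin k → ℕ) → ℝ, IsClassMk k A B ε F →
        ∀ x y : ℝ, c₀ * (polyHeight (∏ j, Q j) : ℝ) ^ δ ≤ x → x ^ α < y → y ≤ x →
          ∑ n ∈ (Finset.Ioc ⌊x⌋₊ ⌊x + y⌋₊).filter (fun n : ℕ => (∏ j, Q j).eval (n : ℤ) ≠ 0),
              F (fun j => ((Q j).eval (n : ℤ)).natAbs) ≤
            C * y * (∏ p ∈ (Finset.Icc 1 ⌊x⌋₊).filter Nat.Prime, (1 - (polyRootCountMod Q p : ℝ) / p)) *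
              ∑ n ∈ (Fintype.piFinset fun _ : Fin k => Finset.Icc 1 ⌊x⌋₊).filter (fun n => ∏ j, n j ≤ ⌊x⌋₊),
                F n * ∏ j, ((polyRootCountMod ![Q j] (n j) : ℝ) / (n j)) := by
  intro hP k g D₀ A B α δ ε hk hA hB hα hα1 hδ hδ1 hε hεg
  have hNT := NairTenenbaum1998_theorem1_printed.henriotForm hP
  choose c₀ C hC using fun D : ℤ => hNT k g D A B α δ ε hk hA hB hα hα1 hδ hδ1 hε hεg
  set S : Finset ℤ := Finset.Icc (-(D₀ : ℤ)) D₀ with hS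
  refine ⟨∑ D ∈ S, max (c₀ D) 0, ∑ D ∈ S, max (C D) 0, Finset.sum_nonneg fun D _ => le_max_right _ _,
    Finset.sum_nonneg fun D _ => le_max_right _ _, ?_⟩
  intro Q hirr hcop hfix hdeg hdisc F hF x y hx hxy hyx
  set D := (∏ j, Q j).discr with hD
  have hDS : D ∈ S := by
    rw [hS, Finset.mem_Icc]
    exact abs_le.mp hdisc
  have hc₀ : c₀ D ≤ ∑ D ∈ S, max (c₀ D) 0 :=
    (le_max_left _ _).trans (Finset.single_le_sum (f := fun D => max (c₀ D) 0) (fun D _ => le_max_right _ _) hDS)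
  have hCle : C D ≤ ∑ D ∈ S, max (C D) 0 :=
    (le_max_left _ _).trans (Finset.single_le_sum (f := fun D => max (C D) 0) (fun D _ => le_max_right _ _) hDS)
  have hH0 : (0 : ℝ) ≤ (polyHeight (∏ j, Q j) : ℝ) ^ δ := Real.rpow_nonneg (Nat.cast_nonneg _) _
  have hx' : c₀ D * (polyHeight (∏ j, Q j) : ℝ) ^ δ ≤ x := (mul_le_mul_of_nonneg_right hc₀ hH0).trans hx
  have h := hC D Q hirr hcop hfix hdeg rfl F hF x y hx' hxy hyx
  refine h.trans ?_
  have hx0 : 0 ≤ x := le_trans (mul_nonneg (Finset.sum_nonneg fun D _ => le_max_right _ _) hH0) hx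
  have hy0 : 0 ≤ y := le_trans (Real.rpow_nonneg hx0 α) hxy.le
  have hP0 : 0 ≤ ∏ p ∈ (Finset.Icc 1 ⌊x⌋₊).filter Nat.Prime, (1 - (polyRootCountMod Q p : ℝ) / p) :=
    Finset.prod_nonneg fun p hp => by
      have hp' := (Finset.mem_filter.mp hp).2
      have : (polyRootCountMod Q p : ℝ) ≤ p := by exact_mod_cast polyRootCountMod_le Q p
      have hp0 : (0 : ℝ) < p := by exact_mod_cast hp'.pos
      rw [sub_nonneg, div_le_one hp0]
      exact this
  have hS0 : 0 ≤ ∑ n ∈ (Fintype.piFinset fun _ : Fin k => Finset.Icc 1 ⌊x⌋₊).filter (fun n => ∏ j, n j ≤ ⌊x⌋₊),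
      F n * ∏ j, ((polyRootCountMod ![Q j] (n j) : ℝ) / (n j)) :=
    Finset.sum_nonneg fun n _ => mul_nonneg (hF.1 n) (Finset.prod_nonneg fun j _ => by positivity)
  have : C D * y * (∏ p ∈ (Finset.Icc 1 ⌊x⌋₊).filter Nat.Prime, (1 - (polyRootCountMod Q p : ℝ) / p)) ≤
      (∑ D ∈ S, max (C D) 0) * y * (∏ p ∈ (Finset.Icc 1 ⌊x⌋₊).filter Nat.Prime, (1 - (polyRootCountMod Q p : ℝ) / p)) :=
    mul_le_mul_of_nonneg_right (mul_le_mul_of_nonneg_right hCle hy0) hP0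
  exact mul_le_mul_of_nonneg_right this hS0

end

end Summit.Parity.BatemanHorn.Cruxes.LSDRealSegment.ProductAnatomySubcritical
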